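import Summits.Ventures.CertifiedManyBodySolver.Observables.StructureFactorsLROCeiling

/-!
# LRO ceiling, STAR form: the Parseval bound keeps every momentum of a finite set at once

HONEST FRAMING: first certified bounds; not a superconductivity verdict; every number certified or
labelled float.  Exact finite-torus theorems only (speedrun `mbsolver`, seat sr-mbsolver-m3-4, gen 6;
companion of `StructureFactorsLROCeiling`).

`StructureFactorsLROCeiling` drops all but ONE term of the Parseval identity
`Σ_k |f̂(k)|² S(k; ψ) = Re ⟨ψ, Σ_{r,r'} f(r) f̄(r') W_{r−r'} ψ⟩`.  Keeping a finite set `K` of momenta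
(in practice the point-group star of a stripe wavevector, or the star together with `(π,π)`) gives

  **`Σ_{k ∈ K} |f̂(k)|² · S(k; ψ) ≤ L² · Σ_{r,r'} Re(f(r) f̄(r')) · C(r − r'; ψ)`**

(`sum_normSq_tap_mul_spinStructureFactor_le_sum_spinCorr`, density twin, window forms, and the
connected density form with the Bragg peak `|f̂(0)|² N²/L²` split off when `0 ∉ K`).  For the
`D₄`-averaged states bounded by the M3 window certificates every member of a star carries the same
weight, so the certified functional bounds the star-averaged squared order parameter with the SUM of
the tap gains over the star in the denominator (charge design of the gen-6 rows: `23/9 + √2/3 = 3.027`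
instead of `0.944`; spin design: `2(1 + cos(π/8)) = 3.848` instead of `0.962`) — words-level TL reading
as in `StructureFactorsLROCeiling` (lead ruling r92: no TL instance is typed).
-/

noncomputable section

namespace Summit.Ventures.CertifiedManyBodySolver.Observables

open Literature.MathematicalPhysics.QuantumLattice Literature.Probability.LatticeModels
open scoped BigOperators ComplexConjugate

variable (L : ℕ) [NeZero L]

section LROCeilingStar

/-- **Star form, spin channel**: `Σ_{k∈K} |f̂(k)|² S_s(k; ψ) ≤ Re ⟨ψ, Σ_{r,r'} f(r) f̄(r') W_{r−r'} ψ⟩`. -/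
theorem sum_normSq_tap_mul_spinStructureFactor_le (K : Finset (TorusSite 2 L))
    (f : TorusSite 2 L → ℂ) (ψ : Fock (Orb (FermionTorus 2 L))) :
    ∑ k ∈ K, ‖(∑ r : TorusSite 2 L, f r * blochPhase L k r)‖ ^ 2 * spinStructureFactor L k ψ ≤
      (∑ r : TorusSite 2 L, ∑ r' : TorusSite 2 L,
        f r * star (f r') * expect (spinCorrSum L (r - r')) ψ).re := by
  rw [← sum_normSq_tap_mul_spinStructureFactor]
  exact Finset.sum_le_sum_of_subset_of_nonneg (Finset.subset_univ K)
    (fun k _ _ => mul_nonneg (sq_nonneg _) (spinStructureFactor_nonneg L k ψ))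

/-- **Star form, density channel**: `Σ_{k∈K} |f̂(k)|² S_c(k; ψ) ≤ Re ⟨ψ, Σ_{r,r'} f(r) f̄(r') N_{r−r'} ψ⟩`. -/
theorem sum_normSq_tap_mul_densityStructureFactor_le (K : Finset (TorusSite 2 L))
    (f : TorusSite 2 L → ℂ) (ψ : Fock (Orb (FermionTorus 2 L))) :
    ∑ k ∈ K, ‖(∑ r : TorusSite 2 L, f r * blochPhase L k r)‖ ^ 2 * densityStructureFactor L k ψ ≤
      (∑ r : TorusSite 2 L, ∑ r' : TorusSite 2 L,
        f r * star (f r') * expect (densityCorrSum L (r - r')) ψ).re := by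
  rw [← sum_normSq_tap_mul_densityStructureFactor]
  exact Finset.sum_le_sum_of_subset_of_nonneg (Finset.subset_univ K)
    (fun k _ _ => mul_nonneg (sq_nonneg _) (densityStructureFactor_nonneg L k ψ))

/-- **Star form, density channel, connected, `N`-particle sector**: for a finite set `K` of NONZERO
momenta and a unit `N`-particle vector, the Bragg peak `S_c(0; ψ) = N²/L²` is split off as well:
`Σ_{k∈K} |f̂(k)|² S_c(k; ψ) + |f̂(0)|² N²/L² ≤ Re ⟨ψ, Σ_{r,r'} f(r) f̄(r') N_{r−r'} ψ⟩`. -/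
theorem sum_normSq_tap_mul_densityStructureFactor_add_le_of_isNParticle {N : ℕ}
    {ψ : Fock (Orb (FermionTorus 2 L))} (hψ : IsNParticle N ψ) (hnorm : star ψ ⬝ᵥ ψ = 1)
    (K : Finset (TorusSite 2 L)) (hK : (0 : TorusSite 2 L) ∉ K) (f : TorusSite 2 L → ℂ) :
    ∑ k ∈ K, ‖(∑ r : TorusSite 2 L, f r * blochPhase L k r)‖ ^ 2 * densityStructureFactor L k ψ +
        ‖(∑ r : TorusSite 2 L, f r * blochPhase L 0 r)‖ ^ 2 * ((N : ℝ) ^ 2 / (L : ℝ) ^ 2) ≤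
      (∑ r : TorusSite 2 L, ∑ r' : TorusSite 2 L,
        f r * star (f r') * expect (densityCorrSum L (r - r')) ψ).re := by
  have h0 : densityStructureFactor L 0 ψ = (N : ℝ) ^ 2 / (L : ℝ) ^ 2 := by
    rw [densityStructureFactor_zero_of_isNParticle L hψ, hnorm]
    simp
  rw [← sum_normSq_tap_mul_densityStructureFactor, ← h0, add_comm,
    ← Finset.sum_insert (f := fun k => ‖(∑ r : TorusSite 2 L, f r * blochPhase L k r)‖ ^ 2 *
      densityStructureFactor L k ψ) hK]
  exact Finset.sum_le_sum_of_subset_of_nonneg (Finset.subset_univ _)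
    (fun k _ _ => mul_nonneg (sq_nonneg _) (densityStructureFactor_nonneg L k ψ))

/-- `Re (Σ_{r,r'} c_{rr'} · ⟨ψ, B_{r−r'} ψ⟩) = L² Σ_{r,r'} c_{rr'} · (Re⟨ψ, B_{r−r'} ψ⟩ / L²)` for real `c`. -/
private theorem re_sum_sum_ofReal_mul_star (c : TorusSite 2 L → TorusSite 2 L → ℝ) (w : TorusSite 2 L → ℂ) :
    (∑ r : TorusSite 2 L, ∑ r' : TorusSite 2 L, ((c r r' : ℝ) : ℂ) * w (r - r')).re =
      (L : ℝ) ^ 2 * ∑ r : TorusSite 2 L, ∑ r' : TorusSite 2 L, c r r' * ((w (r - r')).re / (L : ℝ) ^ 2) := by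
  have hL : (L : ℝ) ≠ 0 := Nat.cast_ne_zero.mpr (NeZero.ne L)
  rw [Complex.re_sum, Finset.mul_sum]
  refine Finset.sum_congr rfl fun r _ => ?_
  rw [Complex.re_sum, Finset.mul_sum]
  refine Finset.sum_congr rfl fun r' _ => ?_
  rw [Complex.re_ofReal_mul]
  field_simp

/-- Window reduction of the double sum (taps supported on `A`). -/
private theorem sum_sum_indicator_re_mul_star (A : Finset (TorusSite 2 L)) (c : TorusSite 2 L → ℂ)
    (C : TorusSite 2 L → ℝ) :
    ∑ r : TorusSite 2 L, ∑ r' : TorusSite 2 L,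
        ((fun r => if r ∈ A then c r else 0) r * star ((fun r => if r ∈ A then c r else 0) r')).re *
          C (r - r') =
      ∑ a ∈ A, ∑ a' ∈ A, (c a * star (c a')).re * C (a - a') := by
  have h : ∀ r r' : TorusSite 2 L,
      ((fun r => if r ∈ A then c r else 0) r * star ((fun r => if r ∈ A then c r else 0) r')).re *
          C (r - r') =
        if r ∈ A then (if r' ∈ A then (c r * star (c r')).re * C (r - r') else 0) else 0 := by
    intro r r'
    by_cases hr : r ∈ A <;> by_cases hr' : r' ∈ A <;> simp [hr, hr']
  simp_rw [h]
  have inner : ∀ r : TorusSite 2 L,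
      (∑ r' : TorusSite 2 L,
          if r ∈ A then (if r' ∈ A then (c r * star (c r')).re * C (r - r') else 0) else 0) =
        if r ∈ A then ∑ r' ∈ A, (c r * star (c r')).re * C (r - r') else 0 := by
    intro r
    split_ifs with hr
    · rw [Finset.sum_ite_mem, Finset.univ_inter]
    · simp
  simp_rw [inner]
  rw [Finset.sum_ite_mem, Finset.univ_inter]

/-- **Star form, spin channel, per-site**:
`Σ_{k∈K} |f̂(k)|² · S_s(k; ψ) ≤ L² · Σ_{r,r'} Re(f(r) f̄(r')) · C_s(r − r'; ψ)`. -/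
theorem sum_normSq_tap_mul_spinStructureFactor_le_sum_spinCorr (K : Finset (TorusSite 2 L))
    (f : TorusSite 2 L → ℂ) (ψ : Fock (Orb (FermionTorus 2 L))) :
    ∑ k ∈ K, ‖(∑ r : TorusSite 2 L, f r * blochPhase L k r)‖ ^ 2 * spinStructureFactor L k ψ ≤
      (L : ℝ) ^ 2 * ∑ r : TorusSite 2 L, ∑ r' : TorusSite 2 L,
        (f r * star (f r')).re * spinCorr L (r - r') ψ := by
  have h := sum_normSq_tap_mul_spinStructureFactor_le L K f ψ
  rw [sum_sum_mul_star_mul_eq_re L f (fun d => expect (spinCorrSum L d) ψ)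
      (fun d => by simp only [spinCorrSum_neg])] at h
  have h3 : (∑ r : TorusSite 2 L, ∑ r' : TorusSite 2 L,
      (((f r * star (f r')).re : ℝ) : ℂ) * expect (spinCorrSum L (r - r')) ψ).re =
      (L : ℝ) ^ 2 * ∑ r : TorusSite 2 L, ∑ r' : TorusSite 2 L,
        (f r * star (f r')).re * spinCorr L (r - r') ψ :=
    re_sum_sum_ofReal_mul_star L (fun r r' => (f r * star (f r')).re) (fun d => expect (spinCorrSum L d) ψ)
  exact h.trans_eq h3

/-- **Star form, density channel, per-site**:
`Σ_{k∈K} |f̂(k)|² · S_c(k; ψ) ≤ L² · Σ_{r,r'} Re(f(r) f̄(r')) · C_c(r − r'; ψ)`. -/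
theorem sum_normSq_tap_mul_densityStructureFactor_le_sum_densityCorr (K : Finset (TorusSite 2 L))
    (f : TorusSite 2 L → ℂ) (ψ : Fock (Orb (FermionTorus 2 L))) :
    ∑ k ∈ K, ‖(∑ r : TorusSite 2 L, f r * blochPhase L k r)‖ ^ 2 * densityStructureFactor L k ψ ≤
      (L : ℝ) ^ 2 * ∑ r : TorusSite 2 L, ∑ r' : TorusSite 2 L,
        (f r * star (f r')).re * densityCorr L (r - r') ψ := by
  have h := sum_normSq_tap_mul_densityStructureFactor_le L K f ψ
  rw [sum_sum_mul_star_mul_eq_re L f (fun d => expect (densityCorrSum L d) ψ)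
      (fun d => by simp only [densityCorrSum_neg])] at h
  have h3 : (∑ r : TorusSite 2 L, ∑ r' : TorusSite 2 L,
      (((f r * star (f r')).re : ℝ) : ℂ) * expect (densityCorrSum L (r - r')) ψ).re =
      (L : ℝ) ^ 2 * ∑ r : TorusSite 2 L, ∑ r' : TorusSite 2 L,
        (f r * star (f r')).re * densityCorr L (r - r') ψ :=
    re_sum_sum_ofReal_mul_star L (fun r r' => (f r * star (f r')).re) (fun d => expect (densityCorrSum L d) ψ)
  exact h.trans_eq h3

/-- **Star form, spin channel, window taps**: for taps `c` on a finite window `A` and momenta `K`,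
`Σ_{k∈K} |Σ_{a∈A} c_a e^{ik·a}|² · S_s(k; ψ) ≤ L² · Σ_{a,a'∈A} Re(c_a c̄_{a'}) · C_s(a − a'; ψ)`. -/
theorem sum_normSq_sum_mul_spinStructureFactor_le_window (K : Finset (TorusSite 2 L))
    (A : Finset (TorusSite 2 L)) (c : TorusSite 2 L → ℂ) (ψ : Fock (Orb (FermionTorus 2 L))) :
    ∑ k ∈ K, ‖∑ a ∈ A, c a * blochPhase L k a‖ ^ 2 * spinStructureFactor L k ψ ≤
      (L : ℝ) ^ 2 * ∑ a ∈ A, ∑ a' ∈ A, (c a * star (c a')).re * spinCorr L (a - a') ψ := by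
  have h := sum_normSq_tap_mul_spinStructureFactor_le_sum_spinCorr L K
    (fun r => if r ∈ A then c r else 0) ψ
  simp_rw [sum_indicator_mul_blochPhase] at h
  rwa [sum_sum_indicator_re_mul_star L A c (fun d => spinCorr L d ψ)] at h

/-- **Star form, density channel, window taps**:
`Σ_{k∈K} |Σ_{a∈A} c_a e^{ik·a}|² · S_c(k; ψ) ≤ L² · Σ_{a,a'∈A} Re(c_a c̄_{a'}) · C_c(a − a'; ψ)`. -/
theorem sum_normSq_sum_mul_densityStructureFactor_le_window (K : Finset (TorusSite 2 L))
    (A : Finset (TorusSite 2 L)) (c : TorusSite 2 L → ℂ) (ψ : Fock (Orb (FermionTorus 2 L))) :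
    ∑ k ∈ K, ‖∑ a ∈ A, c a * blochPhase L k a‖ ^ 2 * densityStructureFactor L k ψ ≤
      (L : ℝ) ^ 2 * ∑ a ∈ A, ∑ a' ∈ A, (c a * star (c a')).re * densityCorr L (a - a') ψ := by
  have h := sum_normSq_tap_mul_densityStructureFactor_le_sum_densityCorr L K
    (fun r => if r ∈ A then c r else 0) ψ
  simp_rw [sum_indicator_mul_blochPhase] at h
  rwa [sum_sum_indicator_re_mul_star L A c (fun d => densityCorr L d ψ)] at h

/-- **Star form, density channel, connected window taps on the `N`-particle sector** (`0 ∉ K`):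
`Σ_{k∈K} |Σ_{a∈A} c_a e^{ik·a}|² S_c(k; ψ) + |Σ_{a∈A} c_a|² N²/L² ≤ L² Σ_{a,a'∈A} Re(c_a c̄_{a'}) C_c(a − a'; ψ)`,
i.e. with `n = N/L²`: `Σ_{k∈K} |ĉ(k)|² S_c(k; ψ)/L² ≤ Σ_{a,a'∈A} Re(c_a c̄_{a'}) (C_c(a − a'; ψ) − n²)`. -/
theorem sum_normSq_sum_mul_densityStructureFactor_add_le_window_of_isNParticle {N : ℕ}
    {ψ : Fock (Orb (FermionTorus 2 L))} (hψ : IsNParticle N ψ) (hnorm : star ψ ⬝ᵥ ψ = 1)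
    (K : Finset (TorusSite 2 L)) (hK : (0 : TorusSite 2 L) ∉ K)
    (A : Finset (TorusSite 2 L)) (c : TorusSite 2 L → ℂ) :
    ∑ k ∈ K, ‖∑ a ∈ A, c a * blochPhase L k a‖ ^ 2 * densityStructureFactor L k ψ +
        ‖∑ a ∈ A, c a‖ ^ 2 * ((N : ℝ) ^ 2 / (L : ℝ) ^ 2) ≤
      (L : ℝ) ^ 2 * ∑ a ∈ A, ∑ a' ∈ A, (c a * star (c a')).re * densityCorr L (a - a') ψ := by
  have h := sum_normSq_tap_mul_densityStructureFactor_add_le_of_isNParticle L hψ hnorm K hK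
    (fun r => if r ∈ A then c r else 0)
  rw [sum_sum_mul_star_mul_eq_re L _ (fun d => expect (densityCorrSum L d) ψ)
      (fun d => by simp only [densityCorrSum_neg])] at h
  have h3 : (∑ r : TorusSite 2 L, ∑ r' : TorusSite 2 L,
      ((((fun r => if r ∈ A then c r else 0) r * star ((fun r => if r ∈ A then c r else 0) r')).re
        : ℝ) : ℂ) * expect (densityCorrSum L (r - r')) ψ).re =
      (L : ℝ) ^ 2 * ∑ r : TorusSite 2 L, ∑ r' : TorusSite 2 L,
        ((fun r => if r ∈ A then c r else 0) r * star ((fun r => if r ∈ A then c r else 0) r')).re *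
          densityCorr L (r - r') ψ :=
    re_sum_sum_ofReal_mul_star L _ (fun d => expect (densityCorrSum L d) ψ)
  simp_rw [sum_indicator_mul_blochPhase] at h
  simp_rw [blochPhase_zero_left, mul_one] at h
  rw [sum_sum_indicator_re_mul_star L A c (fun d => densityCorr L d ψ)] at h3
  exact h.trans_eq h3

end LROCeilingStar

end Summit.Ventures.CertifiedManyBodySolver.Observables
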